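import Mathlib.Algebra.Module.Shrink
import Mathlib.RingTheory.SimpleModule.Basic
import Mathlib.Topology.Algebra.Constructions
import Literature.NumberTheory.Automorphic.ParabolicInduction
import Literature.NumberTheory.Automorphic.PAdicReps
import Literature.NumberTheory.Automorphic.GLReindex
import Literature.RepresentationTheory.Semisimple.SubrepresentationEquiv
import HarnessLib

/-!
# Proofs for `ParabolicInduction` (admissibility): `jacquetGL_isAdmissible` reduced to Jacquet's theorem and Jacquet's lemma

The named fact `Literature.NumberTheory.Automorphic.jacquetGL_isAdmissible F c` (file
`ParabolicInduction`): *for an irreducible smooth complex representation `π` of `GL_n(F)`, `F` a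
non-archimedean local field, and every standard parabolic `P_c`, the Jacquet module `r_c π` is
an admissible representation of `Π_a GL_{n_a}(F)`* (Jacquet 1975; Bernstein–Zelevinsky 1977,
Thm. 2.5 with Prop. 2.3 (e)). As its docstring says, it is the composite of two results which
the tree records as separate named facts:

* **Jacquet's admissibility theorem** (lang.S16), `Literature.NumberTheory.Automorphic.jacquetAdmissibility_gl F`
  (file `PAdicReps`): every irreducible smooth representation of `GL_m(F)` on a complex vector
  space *in the universe of `F`* is admissible (Bernstein–Zelevinsky 1977, Thm. 2.5: "in
  particular, `ω` is admissible"; proof in Jacquet, C. R. Acad. Sci. 280 (1975) and, for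
  `GL(n, F)`, Bernstein–Zelevinsky 1976, Ch. II–III);
* **Jacquet's lemma for `GL_n(F)`**, `Representation.isAdmissible_jacquetGL F c` (file
  `ParabolicGL`): `r_c` carries admissible representations to admissible ones
  (Bernstein–Zelevinsky 1977, Prop. 2.3 (e): "proved by Jacquet").

Conversely the one-block case of `jacquetGL_isAdmissible` (`c` constant, `U_c = 1`, `r_c π ≅ π`)
*is* lang.S16, so no proof can avoid Jacquet's theorem. This file proves, sorry-free, the
**reduction**

`jacquetGL_isAdmissible_of : jacquetAdmissibility_gl F → isAdmissible_jacquetGL F c → jacquetGL_isAdmissible F c`,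

so that the discharge `jacquetGL_isAdmissible_holds` becomes a one-liner once the two upstream
facts are discharged. The reduction is not entirely formal, because `jacquetGL_isAdmissible` is
stated for an arbitrary finite index type `n` and a representation space `V` in an *arbitrary*
universe, while `jacquetAdmissibility_gl` speaks about `GL (Fin m) F` and spaces in the universe
of `F`. The two gaps are closed by

* `Representation.isAdmissible_of_jacquetAdmissibilityStatement`: an irreducible representation
  is cyclic (`IsSimpleModule.toSpanSingleton_surjective` for the simple `ℂ[G]`-module
  `π.asModule`), hence its space is `Small.{u}` for `u` the universe of `G` and the
  representation can be transported to `Shrink.{u} V` (`Shrink.linearEquiv`); smoothness,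
  irreducibility and admissibility are invariant under equivalence of representations
  (`Representation.Equiv.stabilizerSubgroup_apply`,
  `Literature.RepresentationTheory.Semisimple.Representation.isIrreducible_of_equiv`,
  `Representation.IsAdmissible.of_equiv`);
* transport along the topological group isomorphism `reindexGL e : GL n F ≃* GL (Fin N) F`
  (`Literature.NumberTheory.Automorphic.reindexGL`, file `GLReindex`; continuity
  `continuous_reindexGL`): `Representation.IsSmooth.comp`, `Representation.IsAdmissible.comp_mulEquiv`,
  `Literature.NumberTheory.Automorphic.isIrreducible_comp_of_surjective`.

No new definition and no new named fact is introduced (D-0026): theorems only.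

## Caveat: dropped local-field hypotheses

The three facts were written as `def`s under
`variable [ValuativeRel F] [TopologicalSpace F] [IsNonarchimedeanLocalField F]`, and a `def`
absorbs only the section variables its body uses, so as first vendored they took
`[Field F] [TopologicalSpace F]` only and quantified over a field with an *arbitrary* topology —
closed statements that are not the cited theorems and are false (for `jacquetAdmissibility_gl`
and `jacquetGL_isAdmissible`: `GL₁(ℂ) = ℂˣ` with the discrete topology has irreducible complex
representations of infinite dimension, e.g. the field `L = ℂ(t)((t - a)^{1/m} : a ∈ ℂ, m ≥ 1)`,
the `ℂ`-span of the divisible group `ℂˣ · ⟨(t - a)^{1/m}⟩ ≅ μ_∞ ⊕ ℚ^{(𝔠)} ≅ ℂˣ`, which are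
smooth but not admissible for the discrete topology). `Representation.isAdmissible_jacquetGL` has
been repaired (explicit binders, file `ParabolicGL`, 2026-08-15) and the same repair of
`jacquetGL_isAdmissible` accompanies this file; `jacquetAdmissibility_gl` (file `PAdicReps`) still
has the defect at the time of writing. The reduction below is an implication at a fixed
non-archimedean local field `F`, where all instances are present, so it elaborates against
either form of the three constants; the eventual discharges must be of the repaired statements.

## References

* H. Jacquet, *Sur les représentations des groupes réductifs p-adiques*, C. R. Acad. Sci. Paris
  Sér. A 280 (1975), 1271–1272 (not held; cited after Bernstein–Zelevinsky 1977, ref. [10]).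
* I. N. Bernstein, A. V. Zelevinsky, *Induced representations of reductive `p`-adic groups I*,
  Ann. Sci. ÉNS (4) 10 (1977), 441–472: Prop. 2.3 (e) and Thm. 2.5 (read in the galaxy copy
  `paper:galaxy-pdf-5846323419317184580`, chunks 7–8).
* I. N. Bernstein, A. V. Zelevinsky, *Representations of the group `GL(n, F)` where `F` is a
  non-archimedean local field*, Russian Math. Surveys 31:3 (1976), 1–68, §3.25 (not held).
-/

noncomputable section

open scoped MatrixGroups

universe u v

/-! ### Transport of smoothness, admissibility, irreducibility -/

namespace Representation

section Equiv

variable {k G V W : Type*} [CommRing k] [Group G] [AddCommGroup V] [Module k V]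
  [AddCommGroup W] [Module k W] {ρ : Representation k G V} {σ : Representation k G W}

/-- Along an equivalence of representations `e : ρ ≃ σ` the stabiliser of `e v` in `σ` is the
stabiliser of `v` in `ρ` (`σ g (e v) = e (ρ g v)` and `e` is injective). A deliberate
dot-notation extension of Mathlib's `Representation.Equiv`. [folklore] -/
theorem Equiv.stabilizerSubgroup_apply (e : ρ.Equiv σ) (v : V) :
    σ.stabilizerSubgroup (e v) = ρ.stabilizerSubgroup v := by
  ext g
  have h := e.toIntertwiningMap.isIntertwining ρ σ g v
  rw [Representation.Equiv.coe_toIntertwiningMap] at h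
  rw [mem_stabilizerSubgroup, mem_stabilizerSubgroup, ← h]
  exact e.toLinearEquiv.injective.eq_iff

/-- Along an equivalence of representations `e : ρ ≃ σ`, the `K`-fixed vectors of `σ` are the
image under `e` of the `K`-fixed vectors of `ρ`. A deliberate dot-notation extension of
Mathlib's `Representation.Equiv`. [folklore] -/
theorem Equiv.fixedPoints_eq_map (e : ρ.Equiv σ) (K : Subgroup G) :
    σ.fixedPoints K = (ρ.fixedPoints K).map (e.toLinearEquiv : V →ₗ[k] W) := by
  ext w
  rw [Submodule.mem_map]
  constructor
  · intro hw
    refine ⟨e.symm w, ?_, e.apply_symm_apply w⟩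
    rw [mem_fixedPoints] at hw ⊢
    intro g hg
    apply e.toLinearEquiv.injective
    have h := e.toIntertwiningMap.isIntertwining ρ σ g (e.symm w)
    rw [Representation.Equiv.coe_toIntertwiningMap, Representation.Equiv.apply_symm_apply] at h
    change e (ρ g (e.symm w)) = e (e.symm w)
    rw [h, hw g hg, Representation.Equiv.apply_symm_apply]
  · rintro ⟨v, hv, rfl⟩
    rw [mem_fixedPoints] at hv ⊢
    intro g hg
    have h := e.toIntertwiningMap.isIntertwining ρ σ g v
    rw [Representation.Equiv.coe_toIntertwiningMap] at h
    change σ g (e v) = e v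
    rw [← h, hv g hg]

variable [TopologicalSpace G]

/-- **Admissibility is an isomorphism invariant**: if `ρ` is admissible and `e : ρ ≃ σ` is an
equivalence of representations then `σ` is admissible (stabilisers correspond by
`Equiv.stabilizerSubgroup_apply`, fixed vectors by `Equiv.fixedPoints_eq_map`, and the image of a
finitely generated submodule is finitely generated). A deliberate dot-notation extension of the
tree's `Representation.IsAdmissible` (file `SmoothRepresentation`).
(Bernstein–Zelevinsky 1976, §2.1; folklore.) [folklore] -/
theorem IsAdmissible.of_equiv (h : ρ.IsAdmissible) (e : ρ.Equiv σ) : σ.IsAdmissible := by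
  refine ⟨fun w => ?_, fun K hK => ?_⟩
  · change IsOpen (σ.stabilizerSubgroup w : Set G)
    rw [← e.apply_symm_apply w, e.stabilizerSubgroup_apply]
    exact h.1 _
  · haveI := h.2 K hK
    rw [e.fixedPoints_eq_map]
    infer_instance

end Equiv

section Comp

variable {k G H V : Type*} [CommRing k] [Group G] [Group H] [AddCommGroup V] [Module k V]

/-- The stabiliser of `v` under the restriction `σ ∘ f` along a group homomorphism `f : G →* H`
is the preimage of the stabiliser under `σ`. A deliberate dot-notation extension (the tree's
`Representation.stabilizerSubgroup`, file `SmoothRepresentation`). [folklore] -/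
theorem stabilizerSubgroup_comp (σ : Representation k H V) (f : G →* H) (v : V) :
    stabilizerSubgroup (σ.comp f) v = (σ.stabilizerSubgroup v).comap f := by
  ext g
  rfl

/-- The vectors fixed by `K ≤ G` under `σ ∘ f` are the vectors fixed by `f(K) ≤ H` under `σ`.
A deliberate dot-notation extension (`Representation.fixedPoints`, file `SmoothRepresentation`).
[folklore] -/
theorem fixedPoints_comp (σ : Representation k H V) (f : G →* H) (K : Subgroup G) :
    fixedPoints (σ.comp f) K = σ.fixedPoints (K.map f) := by
  ext v
  simp only [mem_fixedPoints, Subgroup.mem_map, forall_exists_index, and_imp,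
    forall_apply_eq_imp_iff₂]
  rfl

variable [TopologicalSpace G] [TopologicalSpace H]

/-- **Smoothness pulls back along continuous homomorphisms**: if `σ` is a smooth representation
of `H` and `f : G →* H` is continuous then `σ ∘ f` is a smooth representation of `G` (the
stabiliser of `v` is the preimage of an open subgroup). A deliberate dot-notation extension of
the tree's `Representation.IsSmooth`. (Bernstein–Zelevinsky 1976, §2.1; folklore.) [folklore] -/
theorem IsSmooth.comp {σ : Representation k H V} (h : σ.IsSmooth) (f : G →* H)
    (hf : Continuous f) : IsSmooth (σ.comp f) := fun v => by
  change IsOpen (stabilizerSubgroup (σ.comp f) v : Set G)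
  rw [stabilizerSubgroup_comp]
  exact (h v).preimage hf

/-- **Admissibility is invariant under isomorphisms of topological groups**: if `σ` is an
admissible representation of `H` and `e : G ≃* H` is a homeomorphic group isomorphism
(continuous and open) then `σ ∘ e` is an admissible representation of `G`: a compact open
subgroup `K ≤ G` has compact open image `e(K) ≤ H`, and `(σ ∘ e)^K = σ^{e(K)}`
(`fixedPoints_comp`). A deliberate dot-notation extension of the tree's
`Representation.IsAdmissible`. (Bernstein–Zelevinsky 1976, §2.1; folklore.) [folklore] -/
theorem IsAdmissible.comp_mulEquiv {σ : Representation k H V} (h : σ.IsAdmissible) (e : G ≃* H)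
    (he : Continuous e) (he' : IsOpenMap e) : IsAdmissible (σ.comp e.toMonoidHom) := by
  refine ⟨h.1.comp e.toMonoidHom he, fun K hK => ?_⟩
  have hopen : IsOpen ((K : Subgroup G).map e.toMonoidHom : Set H) := by
    rw [Subgroup.coe_map]
    exact he' _ K.isOpen
  haveI := h.2 ⟨(K : Subgroup G).map e.toMonoidHom, hopen⟩
    (by
      change IsCompact ((K : Subgroup G).map e.toMonoidHom : Set H)
      rw [Subgroup.coe_map]
      exact hK.image he)
  rw [fixedPoints_comp]
  exact this

end Comp

end Representation

namespace Literature.NumberTheory.Automorphic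

/-- **Irreducibility pulls back along surjective homomorphisms**: if `σ` is an irreducible
representation of `H` and `f : G →* H` is surjective then `σ ∘ f` is irreducible, since `σ ∘ f`
and `σ` have the same stable subspaces (compare `isIrreducible_comp_iff` in
`RankinSelbergLocalTwistProofs`, not imported here to keep this file's imports light).
[folklore] -/
theorem isIrreducible_comp_of_surjective {k G H V : Type*} [Field k] [Group G] [Group H]
    [AddCommGroup V] [Module k V] (σ : Representation k H V) (f : G →* H)
    (hf : Function.Surjective f) [σ.IsIrreducible] :
    Representation.IsIrreducible (σ.comp f) := by
  let e : Subrepresentation (σ.comp f) ≃o Subrepresentation σ :=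
    { toFun := fun U => ⟨U.toSubmodule, fun h v hv => by
        obtain ⟨g, rfl⟩ := hf h
        exact U.apply_mem_toSubmodule g hv⟩
      invFun := fun U => ⟨U.toSubmodule, fun g v hv => U.apply_mem_toSubmodule (f g) hv⟩
      left_inv := fun _ => rfl
      right_inv := fun _ => rfl
      map_rel_iff' := Iff.rfl }
  exact e.isSimpleOrder_iff.2 ‹_›

/-! ### The reindexing isomorphism `GL n F ≃* GL (Fin N) F` is a homeomorphism -/

section Reindex

variable {k : Type*} [Field k] [TopologicalSpace k] {m m' : Type*} [Fintype m] [DecidableEq m]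
  [Fintype m'] [DecidableEq m']

/-- The reindexing isomorphism `reindexGL e : GL m k ≃* GL m' k` (file `GLReindex`) is
continuous: on matrices it permutes coordinates (`Continuous.matrix_reindex`), and a continuous
monoid homomorphism induces a continuous map on units (`Units.continuous_map`). [folklore] -/
theorem continuous_reindexGL (e : m ≃ m') : Continuous (reindexGL (k := k) e) :=
  Units.continuous_map (f := (Matrix.reindexAlgEquiv k k e).toMulEquiv.toMonoidHom)
    (continuous_id.matrix_reindex e e)

/-- `reindexGL e` is an open map (its inverse `reindexGL e.symm` is continuous). [folklore] -/
theorem isOpenMap_reindexGL (e : m ≃ m') : IsOpenMap (reindexGL (k := k) e) := by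
  intro U hU
  have h : (reindexGL (k := k) e) '' U = reindexGL e.symm ⁻¹' U := by
    rw [← reindexGL_symm]
    exact (reindexGL (k := k) e).toEquiv.image_eq_preimage_symm U
  rw [h]
  exact hU.preimage (continuous_reindexGL e.symm)

end Reindex

end Literature.NumberTheory.Automorphic

/-! ### From Jacquet's theorem on `GL (Fin m) F` in universe `u` to all index types and universes -/

namespace Representation

open Literature.NumberTheory.Automorphic

variable {F : Type u} [Field F] [TopologicalSpace F]

/-- **Jacquet's theorem in an arbitrary universe.** If every irreducible smooth representation
of `GL_m(F)` on a complex vector space in the universe of `F` is admissible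
(`JacquetAdmissibilityStatement (GL (Fin m) F)`, the `m`-th instance of lang.S16
`jacquetAdmissibility_gl F`), then so is every irreducible smooth representation `π` of `GL_m(F)`
on a space `V` in *any* universe: `π` is cyclic (`V = ℂ[G] v` for any `v ≠ 0`, the simple
`ℂ[G]`-module `π.asModule`), so `V` is `u`-small and `π` is equivalent to a representation on
`Shrink.{u} V`, to which the hypothesis applies; admissibility transports back along the
equivalence. (Bernstein–Zelevinsky 1977, Thm. 2.5; Jacquet 1975.) [cite: BernsteinZelevinsky1977, Thm. 2.5] -/
theorem isAdmissible_of_jacquetAdmissibilityStatement_fin {m : ℕ}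
    (h16 : JacquetAdmissibilityStatement (GL (Fin m) F)) {V : Type v} [AddCommGroup V]
    [Module ℂ V] (π : Representation ℂ (GL (Fin m) F) V) [π.IsIrreducible] (hπ : π.IsSmooth) :
    π.IsAdmissible := by
  -- `V` is small: `π.asModule` is a simple, hence cyclic, `ℂ[G]`-module
  haveI : Nontrivial π.asModule :=
    IsSimpleModule.nontrivial (MonoidAlgebra ℂ (GL (Fin m) F)) π.asModule
  obtain ⟨x, hx⟩ := exists_ne (0 : π.asModule)
  haveI : Small.{u} π.asModule :=
    small_of_surjective
      (IsSimpleModule.toSpanSingleton_surjective (MonoidAlgebra ℂ (GL (Fin m) F)) hx)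
  haveI : Small.{u} V := small_map π.asModuleEquiv.symm.toEquiv
  -- transport `π` to `Shrink.{u} V`
  let f : V ≃ₗ[ℂ] Shrink.{u} V := (Shrink.linearEquiv ℂ V).symm
  let π' : Representation ℂ (GL (Fin m) F) (Shrink.{u} V) := f.conjRingEquiv.toMonoidHom.comp π
  have hπ' : ∀ g y, π' g y = f (π g (f.symm y)) := fun g y => rfl
  let e : π.Equiv π' :=
    Representation.Equiv.mk f fun g => LinearMap.ext fun y => by
      change f (π g y) = π' g (f y)
      rw [hπ', LinearEquiv.symm_apply_apply]
  have h1 : π'.IsSmooth := fun w => by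
    change IsOpen (π'.stabilizerSubgroup w : Set (GL (Fin m) F))
    rw [← e.apply_symm_apply w, e.stabilizerSubgroup_apply]
    exact hπ _
  haveI : π'.IsIrreducible :=
    Literature.RepresentationTheory.Semisimple.Representation.isIrreducible_of_equiv e
  have h2 : π'.IsAdmissible := h16 (Shrink.{u} V) π' h1 inferInstance
  exact h2.of_equiv e.symm

/-- **Jacquet's theorem for an arbitrary finite index type** (from its `Fin N` instance): if
`JacquetAdmissibilityStatement (GL (Fin (Fintype.card n)) F)` holds then every irreducible
smooth complex representation of `GL n F` (any `Fintype n`, any universe of the space) is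
admissible — transport along the homeomorphic group isomorphism
`reindexGL : GL n F ≃* GL (Fin #n) F` and `isAdmissible_of_jacquetAdmissibilityStatement_fin`.
(Bernstein–Zelevinsky 1977, Thm. 2.5; Jacquet 1975.) [cite: BernsteinZelevinsky1977, Thm. 2.5] -/
theorem isAdmissible_of_jacquetAdmissibilityStatement {n : Type*} [Fintype n] [DecidableEq n]
    (h16 : JacquetAdmissibilityStatement (GL (Fin (Fintype.card n)) F)) {V : Type v}
    [AddCommGroup V] [Module ℂ V] (π : Representation ℂ (GL n F) V) [π.IsIrreducible]
    (hπ : π.IsSmooth) : π.IsAdmissible := by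
  let e : GL n F ≃* GL (Fin (Fintype.card n)) F := reindexGL (Fintype.equivFin n)
  let π₁ : Representation ℂ (GL (Fin (Fintype.card n)) F) V := π.comp e.symm.toMonoidHom
  have h1 : π₁.IsSmooth := hπ.comp e.symm.toMonoidHom (by
    change Continuous (reindexGL (k := F) (Fintype.equivFin n)).symm
    rw [reindexGL_symm]
    exact continuous_reindexGL _)
  haveI : π₁.IsIrreducible := isIrreducible_comp_of_surjective π e.symm.toMonoidHom e.symm.surjective
  have h2 : π₁.IsAdmissible := isAdmissible_of_jacquetAdmissibilityStatement_fin h16 π₁ h1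
  have h3 : IsAdmissible (π₁.comp e.toMonoidHom) :=
    h2.comp_mulEquiv e (continuous_reindexGL _) (isOpenMap_reindexGL _)
  have he : π₁.comp e.toMonoidHom = π := MonoidHom.ext fun g => by
    change π (e.symm (e g)) = π g
    rw [MulEquiv.symm_apply_apply]
  rwa [he] at h3

end Representation

/-! ### The reduction -/

namespace Literature.NumberTheory.Automorphic

open Representation

variable (F : Type u) [Field F] [ValuativeRel F] [TopologicalSpace F] [IsNonarchimedeanLocalField F]
  {n : Type*} [Fintype n] [DecidableEq n] {α : Type*} [LinearOrder α] [Fintype α] (c : n → α)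
  {V : Type v} [AddCommGroup V] [Module ℂ V]

/-- **`jacquetGL_isAdmissible` follows from Jacquet's admissibility theorem and Jacquet's lemma.**
If every irreducible smooth representation of every `GL_m(F)` is admissible (lang.S16,
`jacquetAdmissibility_gl F`; Bernstein–Zelevinsky 1977, Thm. 2.5, Jacquet 1975) and the Jacquet
functor `r_c` of `GL_n(F)` preserves admissibility (`Representation.isAdmissible_jacquetGL F c`;
Bernstein–Zelevinsky 1977, Prop. 2.3 (e)), then the Jacquet module `r_c π` of every irreducible
smooth representation `π` of `GL_n(F)` is admissible (`jacquetGL_isAdmissible F c`). The index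
type `n` and the universe of the representation space are arbitrary
(`Representation.isAdmissible_of_jacquetAdmissibilityStatement`). This is exactly the argument
recorded in the docstring of `jacquetGL_isAdmissible`; its discharge `jacquetGL_isAdmissible_holds`
is this theorem applied to the discharges of the two hypotheses (see the module docstring,
"Caveat", for the repaired forms of the three constants).
(Jacquet 1975; Bernstein–Zelevinsky 1977, Thm. 2.5 and Prop. 2.3 (e).) [cite: Jacquet1975] -/
theorem jacquetGL_isAdmissible_of (h16 : jacquetAdmissibility_gl F)
    (hJ : isAdmissible_jacquetGL.{u, _, _, v} F c) : jacquetGL_isAdmissible F c (V := V) := by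
  intro π _ hπ
  exact hJ π (isAdmissible_of_jacquetAdmissibilityStatement (h16 _) π hπ)

end Literature.NumberTheory.Automorphic
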